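import Summits.Ventures.PercRepro.ProfilePointedContainment

/-!
# PercRepro — (PM⁻): THE CONTAINMENT MATCHING OF THE BI-INDEPENDENT COMPLEX ONE LEVEL BELOW THE MIRROR, A MATCHING FORM
OF THEOREM A's STEP `P_j ≤ P_{j+1}` (p10, gen 26)

For a finite matroid `M` on `n` elements, `BI_j = biIndepSets M j`.  The EXACT mirror matching (PM) «`BI_j → BI_{n−j}` has a
perfect matching» is FALSE (gen 26: `Θ₃` + chord, `n = 7`, `j = 3`; 583 of the 192,417 `(M, j)` on 9 elements).  ONE LEVEL
BELOW THE MIRROR it survives everything tested: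

  (PM⁻)  for every `2j + 2 ≤ n` the containment graph `BI_j → BI_{n−1−j}` has a matching saturating `BI_j`

(`BiIndepSupShift`; 0 failures on every matroid with ≤ 9 elements — kit j297722, 1,387 instances with 77,405 sources at
`n = 9` — and on random binary / graphic / sparse-paving matroids on 10–12 elements), and so does the CONSECUTIVE containment
`BI_j → BI_{j+1}` (`BiIndepSupCons`, the same censuses).  Both give Theorem A's unnormalised step `P_j ≤ P_{j+1}` for
`2j + 2 ≤ n` by an injection (`card_biIndepSets_le_succ_of_shift`, `card_biIndepSets_le_succ_of_cons`; `P_{n−1−j} = P_{j+1}` by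
complementation) — a statement the tree otherwise has only from the named fact (`biIndepDensity_mono_of_fact`).  (PM⁻) is
(H-SUP) at every parallel-pair extension: at `p ∥ e`, `𝒦_k(M, p) ≅ BI_{k−1}(M / p / e)` and `𝒦_{N−1−k} ≅ BI_{N−2−k}(M / p / e)`
through `X ↦ X ∖ e`, containment to containment (paper P10-MIRROR-g26.md §4d).  Nothing here asserts (PM⁻), (Cons) or Theorem A.
-/

open scoped Matroid

namespace PercRepro.Cogirth

open Finset ThmH Skew

variable {α : Type} [DecidableEq α] {M : Matroid α} [M.Finite]

/-- **(PM⁻) (NOT asserted)**: for every finite matroid on `α` and every `2j + 2 ≤ n`, an injection `f` on `BI_j` with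
`X ⊆ f X ∈ BI_{n−1−j}`. -/
def BiIndepSupShift (α : Type) [DecidableEq α] : Prop :=
  ∀ (M : Matroid α) [M.Finite] (j : ℕ), 2 * j + 2 ≤ (gr M).card →
    ∃ f : Finset α → Finset α, Set.InjOn f (biIndepSets M j) ∧
      ∀ X ∈ biIndepSets M j, f X ∈ biIndepSets M ((gr M).card - 1 - j) ∧ X ⊆ f X

/-- **(Cons) (NOT asserted)**: for every finite matroid on `α` and every `2j + 2 ≤ n`, an injection `f` on `BI_j` with
`X ⊆ f X ∈ BI_{j+1}`. -/
def BiIndepSupCons (α : Type) [DecidableEq α] : Prop :=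
  ∀ (M : Matroid α) [M.Finite] (j : ℕ), 2 * j + 2 ≤ (gr M).card →
    ∃ f : Finset α → Finset α, Set.InjOn f (biIndepSets M j) ∧
      ∀ X ∈ biIndepSets M j, f X ∈ biIndepSets M (j + 1) ∧ X ⊆ f X

/-- (PM⁻) ⟹ Theorem A's unnormalised step `P_j ≤ P_{j+1}` for `2j + 2 ≤ n` (`P_{n−1−j} = P_{j+1}`). -/
theorem card_biIndepSets_le_succ_of_shift (h : BiIndepSupShift α) (M : Matroid α) [M.Finite] {j : ℕ}
    (hj : 2 * j + 2 ≤ (gr M).card) : (biIndepSets M j).card ≤ (biIndepSets M (j + 1)).card := by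
  obtain ⟨f, hinj, hf⟩ := h M j hj
  have h1 : (biIndepSets M j).card ≤ (biIndepSets M ((gr M).card - 1 - j)).card :=
    card_le_card_of_injOn f (fun X hX => (hf X hX).1) hinj
  have h2 := card_biIndepSets_symm M (k := j + 1) (by omega)
  rw [show (gr M).card - (j + 1) = (gr M).card - 1 - j by omega] at h2
  omega

/-- (Cons) ⟹ Theorem A's unnormalised step `P_j ≤ P_{j+1}` for `2j + 2 ≤ n`. -/
theorem card_biIndepSets_le_succ_of_cons (h : BiIndepSupCons α) (M : Matroid α) [M.Finite] {j : ℕ}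
    (hj : 2 * j + 2 ≤ (gr M).card) : (biIndepSets M j).card ≤ (biIndepSets M (j + 1)).card := by
  obtain ⟨f, hinj, hf⟩ := h M j hj
  exact card_le_card_of_injOn f (fun X hX => (hf X hX).1) hinj

/-- Every bi-independent `j`-set with `2j + 2 ≤ n` has a bi-independent superset at every level `j ≤ m ≤ n − 1 − j` (the
ground set minus `p`-free version of gen 17's argument: `E ∖ X` is independent of size `n − j ≥ m`, so `X` extends inside `E`
to an independent `m`-set whose complement is a subset of `E ∖ X`) — no level of (PM⁻) or (Cons) is vacuously false. -/
theorem exists_mem_biIndepSets_superset {j m : ℕ} (hjm : j ≤ m) (hm : m + j ≤ (gr M).card) {X : Finset α}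
    (hX : X ∈ biIndepSets M j) : ∃ X' ∈ biIndepSets M m, X ⊆ X' := by
  rw [mem_biIndepSets] at hX
  obtain ⟨hXg, hXj, hXr, hXc⟩ := hX
  have hXind : M.Indep (X : Set α) := indep_of_rk_eq_card' hXr
  have hEE : ((gr M : Finset α) : Set α) ⊆ M.E := by rw [coe_gr]
  obtain ⟨J, hJ, hXJ⟩ := hXind.subset_isBasis_of_subset (by exact_mod_cast hXg) hEE
  have hJfin : J.Finite := (Finset.finite_toSet _).subset hJ.subset
  have hJ'J : (hJfin.toFinset : Set α) = J := Set.Finite.coe_toFinset hJfin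
  have hJ'card : hJfin.toFinset.card = rk M (gr M) := by
    have h1 := hJ.encard_eq_eRk
    rw [← hJ'J, Set.encard_coe_eq_coe_finsetCard, ← coe_rk] at h1
    exact_mod_cast h1
  have hXJ' : X ⊆ hJfin.toFinset := by
    intro x hx
    rw [Set.Finite.mem_toFinset]
    exact hXJ hx
  have hJ'E : hJfin.toFinset ⊆ gr M := by
    intro x hx
    rw [Set.Finite.mem_toFinset] at hx
    exact_mod_cast hJ.subset hx
  have hrk : (gr M).card - j ≤ rk M (gr M) := by
    have := rk_le_rk_of_subset_finset (M := M) (sdiff_subset : gr M \ X ⊆ gr M)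
    rw [hXc, card_sdiff_of_subset hXg, hXj] at this
    exact this
  obtain ⟨X', hXX', hX'J', hX'card⟩ := exists_subsuperset_card_eq (n := m) hXJ' (by omega) (by omega)
  refine ⟨X', ?_, hXX'⟩
  rw [mem_biIndepSets]
  refine ⟨hX'J'.trans hJ'E, hX'card, ?_, ?_⟩
  · refine rk_eq_card_of_indep' (hJ.indep.subset ?_)
    rw [← hJ'J]
    exact_mod_cast hX'J'
  · exact rk_eq_card_of_subset_of_rk_eq_card (sdiff_subset_sdiff (Subset.refl _) hXX') hXc

end PercRepro.Cogirth
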